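import Mathlib
import HarnessLib
import Summits.Ventures.LatticeQCDFlow.Exactness.Phi4JitteredHMC
import Summits.Ventures.LatticeQCDFlow.Exactness.JitteredHMCReversible

/-!
# Detailed balance of the φ⁴ engine's jittered qpq / pqp HMC kernels, for every jitter law

HONEST FRAMING: exact (Metropolis-corrected) sampling algorithms for lattice gauge theory;
figures of merit are autocorrelation/cost numbers at stated couplings and volumes; no
continuum-physics claim.

Venture `LatticeQCDFlow` (cell pub-lqcd), topic `Exactness`, FANOUT row 9 (eng-latcore, the φ⁴ engine path
`phi4_2d.hmc / hmcpqp(..., tau_jitter)`).  NEW WORK of the cell over the tree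
(`JitteredHMCReversible.jitterHMC_isReversible`; `Phi4JitteredHMC.phi4JitterHMC(PQP)`: the jittered kernels;
`Phi4HMCExact`: the involutive volume-preserving qpq / pqp proposals).  Split off `Phi4JitteredHMC.lean`
(whose definitions and exactness do not need `JitteredHMCReversible`).  Nothing is cited as a fact; no
number is claimed.

* **`phi4JitterHMC_isReversible`**, **`phi4JitterHMCPQP_isReversible`** — the jittered qpq and pqp HMC
  kernels satisfy detailed balance with respect to `e^{−S}·Leb` for every coupling matrix `J`, every `λ`,
  every step / step-number assignment and EVERY jitter law `η`.

NOT CLAIMED: anything quantitative; floating point.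
-/

noncomputable section

namespace Summit.Ventures.LatticeQCDFlow.Exactness

open MeasureTheory ProbabilityTheory ProbabilityTheory.Kernel Set Function Finset
open Summit.Ventures.LatticeQCDFlow.Scoring
open scoped ENNReal

variable {n : ℕ}
variable {Lab : Type*} [Countable Lab] [MeasurableSpace Lab] [MeasurableSingletonClass Lab]
variable (J : Fin (n + 1) → Fin (n + 1) → ℝ) (lam : ℝ) (δ : Lab → ℝ) (N : Lab → ℕ) (η : Measure Lab)

/-- **THE JITTERED qpq UPDATE SATISFIES DETAILED BALANCE** w.r.t. `e^{−S}·Leb`, for every jitter law. -/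
theorem phi4JitterHMC_isReversible [IsProbabilityMeasure η] :
    IsReversible (phi4JitterHMC J lam δ N η)
      ((volume : Measure (Fin (n + 1) → ℝ)).withDensity fun φ =>
        ENNReal.ofReal (Real.exp (-latticePhi4Action J lam φ))) :=
  jitterHMC_isReversible (vol := (volume : Measure (Fin (n + 1) → ℝ))) (volP := (volume : Measure (Fin (n + 1) → ℝ)))
    η (continuous_latticePhi4Action J lam).measurable measurable_phi4Kinetic
    (fun l => hmcProposal_involutive J lam (δ l) (N l)) (fun l => measurePreserving_hmcProposal J lam (δ l) (N l))

/-- **THE JITTERED pqp UPDATE SATISFIES DETAILED BALANCE**, for every jitter law. -/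
theorem phi4JitterHMCPQP_isReversible [IsProbabilityMeasure η] :
    IsReversible (phi4JitterHMCPQP J lam δ N η)
      ((volume : Measure (Fin (n + 1) → ℝ)).withDensity fun φ =>
        ENNReal.ofReal (Real.exp (-latticePhi4Action J lam φ))) :=
  jitterHMC_isReversible (vol := (volume : Measure (Fin (n + 1) → ℝ))) (volP := (volume : Measure (Fin (n + 1) → ℝ)))
    η (continuous_latticePhi4Action J lam).measurable measurable_phi4Kinetic
    (fun l => hmcProposalPQP_involutive J lam (δ l) (N l))
    (fun l => measurePreserving_hmcProposalPQP J lam (δ l) (N l))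

end Summit.Ventures.LatticeQCDFlow.Exactness
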